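import Summits.MatrixMultiplication.MatrixMultiplication.Theses.SnSubsetDichotomy
import Literature.Combinatorics.Enumerative.EntropyBregman

/-!
# `ThresholdSubsetTriples` (crux stmt-MatrixMultiplication-10882, route `SnSubsetDichotomy`) —
# negative-side support IX: line `triality-uniquely-cubing-translate` — fixed points of the twist are paid
# factorially (refuter cdisprove gen 2)

Definition-free copy of §8b of the crux workfile `Cruxes/ThresholdSubsetTriples/Disproof.lean` (v5); the line's
vocabulary (`UniquelyCubing`, `quotTranslate`) is written as local notations.  For `g³ = 1` and `Q(S)·g`
uniquely cubing in `S_n`: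

* `quot_comm_imp_eq` (the skeleton's design rule, copied: no non-trivial quotient commutes with `g`),
  `card_comm_mul_card_le` (`(z, s) ↦ z·s` is injective on `C(g) × S`, so `|C(g)|·|S| ≤ |G|`),
  `factorial_card_fixed_le_card_comm` (`|Fix g|! ≤ |C(g)|`), `card_mul_factorial_fixed_le`:
  `|S| · |Fix g|! ≤ n!` — every fixed point of the twist is paid factorially (`|Fix g| ≤ (1/2 + o(1)) n` at
  threshold from this count alone; the class count `|S| ≤ n!/(3^k k! f!)` gives `1/4`).
* `card_le_threshold_of_fixed_ge` (with the tree's `cast_mul_log_sub_le_log_factorial`) — REFUTED SUB-FAMILY of the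
  line's search space: for every `c > 0` and all large `n`, a twist with `3·|Fix g| ≥ 2n` admits no
  uniquely-cubing `S` with `|S| > √(n!)·e^{-c√n}` (the twist must move more than `n/3` points).

Sources: Neumann 2011 Obs. 2.1; Cohn–Umans 2003 Def. 2.1; BCCGU 2017 (arXiv:1712.02302) §4; the line skeleton
(planner, kernel-checked); folklore.
-/

noncomputable section

set_option linter.dupNamespace false
set_option autoImplicit false

open scoped BigOperators Pointwise

namespace Summit.MatrixMultiplication.MatrixMultiplication.Theorems.ThresholdSubsetTriples.Negative

open Summit.MatrixMultiplication.MatrixMultiplication.Theses.SnSubsetDichotomy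
open Literature.Combinatorics.Additive

section TrialityLine

variable {G : Type*} [Group G] [DecidableEq G]

/-- `UniquelyCubing W g` of the line's skeleton, as a local notation (no new definition): `W` cubes to `1`
only as `g · g · g`. -/
local notation3 (prettyPrint := false) "UniquelyCubing[" W ", " g "]" =>
  ∀ w₁ ∈ (W : Finset _), ∀ w₂ ∈ W, ∀ w₃ ∈ W, w₁ * w₂ * w₃ = 1 → w₁ = g ∧ w₂ = g ∧ w₃ = g

/-- `quotTranslate S g = Q(S)·g` of the skeleton, as a local notation. -/
local notation3 (prettyPrint := false) "quotTranslate[" S ", " g "]" =>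
  Finset.image (fun p => Prod.fst p * (Prod.snd p)⁻¹ * g) (S ×ˢ S)

/-! ## §8b Fixed points of the twist are paid factorially (exact design rule for `C⁺` and the stub) -/

/-- (skeleton's DESIGN RULE 1, `quot_comm_imp_eq`, copied) under unique cubing no non-trivial quotient
`s s'⁻¹` commutes with `g`: `(q g)(q⁻¹ g) g = g³ = 1` would be a second cubing triple. -/
theorem quot_comm_imp_eq (S : Finset G) (g : G) (hg : g ^ 3 = 1)
    (hUC : UniquelyCubing[quotTranslate[S, g], g]) {s s' : G} (hs : s ∈ S) (hs' : s' ∈ S)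
    (hcomm : s * s'⁻¹ * g = g * (s * s'⁻¹)) : s = s' := by
  have hg3 : g * g * g = 1 := by simpa [pow_succ, mul_assoc] using hg
  have hw : ∀ a ∈ S, ∀ b ∈ S, a * b⁻¹ * g ∈ quotTranslate[S, g] :=
    fun a ha b hb => Finset.mem_image.2 ⟨(a, b), Finset.mem_product.2 ⟨ha, hb⟩, rfl⟩
  have hprod : (s * s'⁻¹ * g) * (s' * s⁻¹ * g) * (s * s⁻¹ * g) = 1 := by
    calc (s * s'⁻¹ * g) * (s' * s⁻¹ * g) * (s * s⁻¹ * g)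
        = (g * (s * s'⁻¹)) * (s' * s⁻¹ * g) * (s * s⁻¹ * g) := by rw [hcomm]
      _ = g * g * g := by group
      _ = 1 := hg3
  have key := (hUC _ (hw s hs s' hs') _ (hw s' hs' s hs) _ (hw s hs s hs) hprod).1
  have h1 : s * s'⁻¹ = 1 := mul_right_cancel (key.trans (one_mul g).symm)
  exact mul_inv_eq_one.1 h1

/-- **Centralizer packing.** Under unique cubing `(z, s) ↦ z·s` is injective on `C(g) × S`
(`z s = z' s'` makes `s' s⁻¹ = z'⁻¹ z` commute with `g`), so `|C(g)|·|S| ≤ |G|`. -/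
theorem card_comm_mul_card_le [Fintype G] (S : Finset G) (g : G) (hg : g ^ 3 = 1)
    (hUC : UniquelyCubing[quotTranslate[S, g], g]) :
    (Finset.univ.filter fun z : G => z * g = g * z).card * S.card ≤ Fintype.card G := by
  set Z : Finset G := Finset.univ.filter fun z : G => z * g = g * z with hZ
  have hinj : Set.InjOn (fun p : G × G => p.1 * p.2) ↑(Z ×ˢ S) := by
    rintro ⟨z, s⟩ hp ⟨z', s'⟩ hp' heq
    simp only [Finset.coe_product, Set.mem_prod, Finset.mem_coe, hZ, Finset.mem_filter,
      Finset.mem_univ, true_and] at hp hp'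
    simp only at heq
    -- `s' s⁻¹ = z'⁻¹ z` commutes with `g`
    have hq : s' * s⁻¹ = z'⁻¹ * z := by
      calc s' * s⁻¹ = z'⁻¹ * (z' * s') * s⁻¹ := by group
        _ = z'⁻¹ * (z * s) * s⁻¹ := by rw [heq]
        _ = z'⁻¹ * z := by group
    have hcomm : s' * s⁻¹ * g = g * (s' * s⁻¹) := by
      rw [hq]
      calc z'⁻¹ * z * g = z'⁻¹ * (z * g) := by group
        _ = z'⁻¹ * (g * z) := by rw [hp.1]
        _ = z'⁻¹ * g * z' * (z'⁻¹ * z) := by group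
        _ = z'⁻¹ * (z' * g) * (z'⁻¹ * z) := by rw [hp'.1]; group
        _ = g * (z'⁻¹ * z) := by group
    have hss : s' = s := quot_comm_imp_eq S g hg hUC hp'.2 hp.2 hcomm
    subst hss
    have hzz : z = z' := mul_right_cancel heq
    subst hzz
    rfl
  calc Z.card * S.card = (Z ×ˢ S).card := (Finset.card_product _ _).symm
    _ = ((Z ×ˢ S).image fun p : G × G => p.1 * p.2).card := (Finset.card_image_of_injOn hinj).symm
    _ ≤ (Finset.univ : Finset G).card := Finset.card_le_univ _
    _ = Fintype.card G := Finset.card_univ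

/-- Permutations supported on the fixed points of `g` commute with `g`: `|Fix g|! ≤ |C(g)|`. -/
theorem factorial_card_fixed_le_card_comm {n : ℕ} (g : Equiv.Perm (Fin n)) :
    (Finset.univ.filter fun x : Fin n => g x = x).card.factorial ≤
      (Finset.univ.filter fun z : Equiv.Perm (Fin n) => z * g = g * z).card := by
  set F : Finset (Fin n) := Finset.univ.filter fun x : Fin n => g x = x with hF
  have hmemF : ∀ x : Fin n, x ∈ F ↔ g x = x := fun x => by simp [hF]
  have hcard : (Fintype.card (Equiv.Perm {x // x ∈ F})) = F.card.factorial := by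
    rw [Fintype.card_perm, Fintype.card_coe]
  rw [← hcard, ← Finset.card_univ, ← Finset.card_image_of_injective (Finset.univ)
    (Equiv.Perm.ofSubtype_injective (p := fun x : Fin n => x ∈ F))]
  refine Finset.card_le_card fun z hz => ?_
  obtain ⟨σ, -, rfl⟩ := Finset.mem_image.1 hz
  rw [Finset.mem_filter]
  refine ⟨Finset.mem_univ _, ?_⟩
  ext x
  rw [Equiv.Perm.mul_apply, Equiv.Perm.mul_apply]
  by_cases hx : x ∈ F
  · have hgx : g x = x := (hmemF x).1 hx
    have hy : ((σ ⟨x, hx⟩ : {x // x ∈ F}) : Fin n) ∈ F := (σ ⟨x, hx⟩).2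
    have hgy : g (σ ⟨x, hx⟩ : Fin n) = σ ⟨x, hx⟩ := (hmemF _).1 hy
    rw [hgx, Equiv.Perm.ofSubtype_apply_of_mem σ hx, hgy]
  · have hgx : g x ∉ F := by
      intro h'
      have h1 : g (g x) = g x := (hmemF _).1 h'
      exact hx ((hmemF x).2 (g.injective h1))
    rw [Equiv.Perm.ofSubtype_apply_of_not_mem σ hx, Equiv.Perm.ofSubtype_apply_of_not_mem σ hgx]

/-- **Fixed points of the twist are paid factorially.**  For `g³ = 1` and `Q(S)·g` uniquely cubing in
`S_n`: `|S| · |Fix g|! ≤ n!`.  With `|S| > √(n!)·e^{-c√n}` (any witness of `C⁺`, of `stub_trialityChainDesign`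
or of `stub_blockedHosts`) this forces `|Fix g|! < √(n!)·e^{c√n}`, i.e. `|Fix g| ≤ (1/2 + o(1))·n` from this
crude count already (the sharp class count `|S| ≤ n!/(3^k k! f!)`, skeleton r1-2, gives `f ≤ (1/4+o(1))n`);
in the PRIMARY sub-family of the triality chain line (levels = `g`-orbits) the singleton levels are exactly
`Fix g`, so at most a vanishing-entropy fraction of the chain may consist of singleton steps. -/
theorem card_mul_factorial_fixed_le {n : ℕ} (g : Equiv.Perm (Fin n)) (hg : g ^ 3 = 1)
    (S : Finset (Equiv.Perm (Fin n))) (hUC : UniquelyCubing[quotTranslate[S, g], g]) :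
    S.card * (Finset.univ.filter fun x : Fin n => g x = x).card.factorial ≤ n.factorial := by
  have h1 := card_comm_mul_card_le S g hg hUC
  rw [Fintype.card_perm, Fintype.card_fin] at h1
  calc S.card * (Finset.univ.filter fun x : Fin n => g x = x).card.factorial
      ≤ S.card * (Finset.univ.filter fun z : Equiv.Perm (Fin n) => z * g = g * z).card :=
        Nat.mul_le_mul_left _ (factorial_card_fixed_le_card_comm g)
    _ = (Finset.univ.filter fun z : Equiv.Perm (Fin n) => z * g = g * z).card * S.card := mul_comm _ _
    _ ≤ n.factorial := h1

/-- **A twist fixing two thirds of the points cannot carry a threshold set.**  For every `c > 0`, for all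
large `n`: if `g³ = 1` fixes `f ≥ 2n/3` points and `Q(S)·g` is uniquely cubing then
`|S| ≤ n!/f! ≤ n^{n-f} ≤ n^{n/3} ≤ √(n!)·e^{-c√n}` (`card_mul_factorial_fixed_le`; `log n! ≥ n log n - n` is the tree's
`Literature.Combinatorics.Enumerative.cast_mul_log_sub_le_log_factorial`).
So in `C⁺` / `stub_trialityChainDesign` / `stub_blockedHosts` the twist must MOVE more than `n/3` points
(the skeleton's informal class count sharpens this to `(3/4 - o(1))n`): "few moved points" is a refuted
sub-family of the line's search space. -/
theorem card_le_threshold_of_fixed_ge {c : ℝ} (hc : 0 < c) :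
    ∃ n₀ : ℕ, ∀ n : ℕ, n₀ ≤ n → ∀ g : Equiv.Perm (Fin n), g ^ 3 = 1 →
      ∀ S : Finset (Equiv.Perm (Fin n)), UniquelyCubing[quotTranslate[S, g], g] →
        2 * n ≤ 3 * (Finset.univ.filter fun x : Fin n => g x = x).card →
          (S.card : ℝ) ≤ Real.sqrt (n.factorial : ℝ) * Real.exp (-(c * Real.sqrt (n : ℝ))) := by
  refine ⟨max ⌈Real.exp 6⌉₊ ⌈4 * c ^ 2⌉₊ + 1, fun n hn g hg S hUC hfix => ?_⟩
  set f : ℕ := (Finset.univ.filter fun x : Fin n => g x = x).card with hf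
  have hn1 : 1 ≤ n := le_trans (Nat.le_add_left 1 _) hn
  have hn0 : (0 : ℝ) < n := by exact_mod_cast hn1
  have hne6 : Real.exp 6 ≤ n := (Nat.le_ceil _).trans
    (by exact_mod_cast (le_max_left _ _).trans ((Nat.le_succ _).trans hn))
  have hnc : 4 * c ^ 2 ≤ n := (Nat.le_ceil _).trans
    (by exact_mod_cast (le_max_right _ _).trans ((Nat.le_succ _).trans hn))
  have hlog6 : 6 ≤ Real.log n := (Real.le_log_iff_exp_le hn0).2 hne6
  -- `|S| ≤ n^{n-f}` in ℕ
  have hfn : f ≤ n := by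
    calc f ≤ (Finset.univ : Finset (Fin n)).card := Finset.card_filter_le _ _
      _ = n := by rw [Finset.card_univ, Fintype.card_fin]
  have hpack := card_mul_factorial_fixed_le g hg S hUC
  rw [← hf] at hpack
  have hdesc : n.factorial = f.factorial * n.descFactorial (n - f) := by
    have h := Nat.factorial_mul_descFactorial (Nat.sub_le n f)
    rw [Nat.sub_sub_self hfn] at h
    exact h.symm
  have hS : S.card ≤ n ^ (n - f) := by
    have h1 : S.card * f.factorial ≤ n ^ (n - f) * f.factorial := by
      calc S.card * f.factorial ≤ n.factorial := hpack
        _ = f.factorial * n.descFactorial (n - f) := hdesc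
        _ ≤ f.factorial * n ^ (n - f) := Nat.mul_le_mul_left _ (Nat.descFactorial_le_pow _ _)
        _ = n ^ (n - f) * f.factorial := mul_comm _ _
    exact Nat.le_of_mul_le_mul_right h1 (Nat.factorial_pos f)
  have hm3 : 3 * (n - f) ≤ n := by omega
  -- real form: `|S| ≤ n^{n/3} = exp((n/3) log n)`
  have hS' : (S.card : ℝ) ≤ Real.exp ((n : ℝ) / 3 * Real.log n) := by
    have h1 : (S.card : ℝ) ≤ (n : ℝ) ^ (n - f) := by exact_mod_cast hS
    have h2 : (n : ℝ) ^ (n - f) ≤ (n : ℝ) ^ ((n : ℝ) / 3) := by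
      rw [← Real.rpow_natCast]
      refine Real.rpow_le_rpow_of_exponent_le (by exact_mod_cast hn1) ?_
      have : ((n - f : ℕ) : ℝ) * 3 ≤ n := by exact_mod_cast (by omega : (n - f) * 3 ≤ n)
      linarith
    rw [Real.rpow_def_of_pos hn0, mul_comm] at h2
    exact h1.trans h2
  -- the exponent inequality `(n/3) log n ≤ ½ log n! - c√n`
  have hsqrt : c * Real.sqrt n ≤ n / 2 := by
    have hs0 : 0 ≤ Real.sqrt n := Real.sqrt_nonneg _
    have hss : Real.sqrt n * Real.sqrt n = n := Real.mul_self_sqrt hn0.le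
    have h2c : 2 * c ≤ Real.sqrt n := by
      rw [show 2 * c = Real.sqrt ((2 * c) ^ 2) from (Real.sqrt_sq (by linarith)).symm]
      exact Real.sqrt_le_sqrt (by linarith)
    nlinarith
  have hlogF := Literature.Combinatorics.Enumerative.cast_mul_log_sub_le_log_factorial n
  have hkey : (n : ℝ) / 3 * Real.log n ≤ Real.log (n.factorial : ℝ) / 2 - c * Real.sqrt n := by
    have h6 : (n : ℝ) ≤ (n : ℝ) / 6 * Real.log n := by nlinarith [hlog6, hn0]
    nlinarith [hlogF, hsqrt, h6, hn0, hlog6]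
  have hF0 : (0 : ℝ) < (n.factorial : ℝ) := by exact_mod_cast Nat.factorial_pos n
  calc (S.card : ℝ) ≤ Real.exp ((n : ℝ) / 3 * Real.log n) := hS'
    _ ≤ Real.exp (Real.log (n.factorial : ℝ) / 2 - c * Real.sqrt n) := Real.exp_le_exp.2 hkey
    _ = Real.sqrt (n.factorial : ℝ) * Real.exp (-(c * Real.sqrt (n : ℝ))) := by
        rw [sub_eq_add_neg, Real.exp_add]
        congr 1
        rw [Real.sqrt_eq_rpow (n.factorial : ℝ), Real.rpow_def_of_pos hF0]
        congr 1
        ring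

end TrialityLine


end Summit.MatrixMultiplication.MatrixMultiplication.Theorems.ThresholdSubsetTriples.Negative

end
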